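import Mathlib
import Summits.NavierStokesRegularity.NavierStokesRegularity.Theorems.SubOnsagerCeilingKPStarvedBranchedBarrier
import Summits.NavierStokesRegularity.NavierStokesRegularity.Theorems.OrthantWakeOrthantTableStructure
import HarnessLib

/-!
# A witness of the BRANCHED starved class: the Katz–Pavlović chain with a strong dead-end pump AND a pump-fed side source
# (helper file for the crux `SubOnsagerCeiling.ForwardTailCeilingKP`, stmt-NavierStokesRegularity-27057, `--supports`)

Companion of `Theorems/SubOnsagerCeilingKPStarvedBranched{Starvation,Flux,Barrier}.lean`.  The table below is the architecture of the
refutation witness `α_SB` of the sister crux 25507 (chain on `0`, in-shell pump `0 → 1`, exit feed `1 → 2` into a dead end) PLUS a strong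
in-shell pump `0 → 3` into a second dead-end pocket: feeds `0 → 0` (`1/2`), `1 → 2` (`1/2`); pumps `0 → 3` (`1`), `0 → 1` (`1/2`).
Mode `1` is a PUMP-FED LIVE MODE (it feeds forward), so the table lies outside the general starved class (`starvedNetwork_shellBarrierAt`
asks live modes to be unpumped) and outside every earlier corner; it lies inside the branched class with `Q = {2,3}`, `U = {1}` and Gram
margin `r = 4` (`4·w₀₀² = 1 = P₀₃²`), hence obeys `ShellBarrierAt R ε₀ α` at EVERY `ε₀ ∈ (0, 1]`:
`branchedWitness_nonempty_shellBarrierAt`.  The file checks membership in the crux's hypotheses (`E₂(4)`, orthant, diagonal feeds).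
HONEST FRAMING: MODEL lattice algebra (route SubOnsagerCeiling, rung TL-M2Break); no stub, crux or summit is proved and nothing here bears
on Navier–Stokes regularity. [cite: Tao2016AveragedNS, §4 (4.2)–(4.3)]
-/

noncomputable section

-- the sub-problem namespace `NavierStokesRegularity.NavierStokesRegularity` is the tree's layout (D-0017)
set_option linter.dupNamespace false

namespace Summit.NavierStokesRegularity.NavierStokesRegularity.Theorems

open Finset
open Literature.Analysis.FluidPDE.TaoCascade
open Summit.NavierStokesRegularity.NavierStokesRegularity.Theorems.SubOnsagerCeiling

/-- The live set of the pockets `{2,3}` is `{0,1}`. [this file] -/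
theorem branchedWitness_compl : (({2, 3} : Finset (Fin 4))ᶜ) = {0, 1} := by decide

section BranchedWitness

variable {α : Fin 4 → Fin 4 → Fin 4 → ℤ × ℤ × ℤ → ℝ}
  (hfeed : ∀ i₁ i₂ i₃ : Fin 4, α i₁ i₂ i₃ ((0 : ℤ), (0 : ℤ), (1 : ℤ)) =
      if i₁ = i₂ ∧ ((i₁ = 0 ∧ i₃ = 0) ∨ (i₁ = 1 ∧ i₃ = 2)) then (1 / 2 : ℝ) else 0)
  (hup1 : ∀ i₁ i₂ i₃ : Fin 4, α i₁ i₂ i₃ ((1 : ℤ), (0 : ℤ), (0 : ℤ)) =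
      if i₂ = i₃ ∧ ((i₂ = 0 ∧ i₁ = 0) ∨ (i₂ = 1 ∧ i₁ = 2)) then (-(1 / 4) : ℝ) else 0)
  (hup2 : ∀ i₁ i₂ i₃ : Fin 4, α i₁ i₂ i₃ ((0 : ℤ), (1 : ℤ), (0 : ℤ)) =
      if i₁ = i₃ ∧ ((i₁ = 0 ∧ i₂ = 0) ∨ (i₁ = 1 ∧ i₂ = 2)) then (-(1 / 4) : ℝ) else 0)
  (hin : ∀ i₁ i₂ i₃ : Fin 4, α i₁ i₂ i₃ ((0 : ℤ), (0 : ℤ), (0 : ℤ)) =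
      (if i₁ = i₂ ∧ i₁ = 0 ∧ i₃ = 3 then (1 : ℝ) else 0) + (if ((i₁ = 0 ∧ i₂ = 3) ∨ (i₁ = 3 ∧ i₂ = 0)) ∧ i₃ = 0 then -(1 / 2) else 0) +
        (if i₁ = i₂ ∧ i₁ = 0 ∧ i₃ = 1 then (1 / 2 : ℝ) else 0) +
        (if ((i₁ = 0 ∧ i₂ = 1) ∨ (i₁ = 1 ∧ i₂ = 0)) ∧ i₃ = 0 then -(1 / 4) else 0))
include hfeed hup1 hup2 hin

/-- Symmetry (4.2) and cancellation (4.3) of the branched witness table. [this file] -/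
theorem branchedWitness_symmCanc : (IsSymmetricCoeff α ∧ IsCancellingCoeff α) ∧ α 0 0 1 (0, 0, 0) = 1 / 2 := by
  refine ⟨⟨?_, ?_⟩, by rw [hin]; simp⟩
  · intro i₁ i₂ i₃ μ₁ μ₂ μ₃ hμ
    rw [mem_shiftSet_iff] at hμ
    simp only [Prod.mk.injEq] at hμ
    rcases hμ with ⟨rfl, rfl, rfl⟩ | ⟨rfl, rfl, rfl⟩ | ⟨rfl, rfl, rfl⟩ | ⟨rfl, rfl, rfl⟩
    · simp only [hin]
      fin_cases i₁ <;> fin_cases i₂ <;> fin_cases i₃ <;> simp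
    · simp only [hup1, hup2]
    · simp only [hup1, hup2]
    · simp only [hfeed]
      fin_cases i₁ <;> fin_cases i₂ <;> fin_cases i₃ <;> simp
  · intro i₁ i₂ i₃ μ₁ μ₂ μ₃ hμ
    rw [mem_shiftSet_iff] at hμ
    simp only [Prod.mk.injEq] at hμ
    rcases hμ with ⟨rfl, rfl, rfl⟩ | ⟨rfl, rfl, rfl⟩ | ⟨rfl, rfl, rfl⟩ | ⟨rfl, rfl, rfl⟩ <;>
      simp only [hin, hfeed, hup1, hup2] <;>
      fin_cases i₁ <;> fin_cases i₂ <;> fin_cases i₃ <;> simp <;> norm_num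

/-- `4`-comparability of the branched witness table. [this file] -/
theorem branchedWitness_comparable : IsComparableCoeff 4 α ∧ α 0 0 1 (0, 0, 0) = 1 / 2 := by
  refine ⟨?_, by rw [hin]; simp⟩
  intro i₁ i₂ i₃ μ hμ
  rw [mem_shiftSet_iff] at hμ
  rcases hμ with rfl | rfl | rfl | rfl <;>
    simp only [hin, hfeed, hup1, hup2] <;>
    fin_cases i₁ <;> fin_cases i₂ <;> fin_cases i₃ <;> simp <;> norm_num

/-- The orthant (Kamke) hypothesis of the crux for the branched witness table, via `orthant_iff_coefficients`. [this file] -/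
theorem branchedWitness_orthant :
    (∀ (Y : Fin 4 → ℤ → ℝ → ℝ) (τ : ℝ), (∀ (j : Fin 4) (k : ℤ), 1 ≤ k → 0 ≤ Y j k τ) →
      ∀ δ : ℝ, 0 < δ → ∀ (i : Fin 4) (n : ℤ), 1 ≤ n → Y i n τ = 0 → 0 ≤ quadTerm δ α Y i n τ) ∧ α 0 0 1 (0, 0, 0) = 1 / 2 := by
  refine ⟨?_, by rw [hin]; simp⟩
  rw [orthant_iff_coefficients]
  refine ⟨?_, ?_, ?_⟩
  · intro i y
    simp only [hfeed, Fin.sum_univ_four]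
    fin_cases i
    · simp
      exact mul_self_nonneg _
    · simp
    · simp
      exact mul_self_nonneg _
    · simp
  · intro i a b hbi
    simp only [hup1, hup2]
    fin_cases i <;> fin_cases a <;> fin_cases b <;> simp at hbi ⊢
  · intro i y hy hyi
    simp only [hin, Fin.sum_univ_four]
    fin_cases i
    · have h0 : y 0 = 0 := hyi
      simp [h0]
    · have h1 : y 1 = 0 := hyi
      simp [h1]
      exact mul_self_nonneg _
    · simp
    · simp
      exact mul_self_nonneg _

omit hup1 hup2 in
/-- The branched-class hypotheses of the witness table (`Q = {2,3}`, `U = {1}`, pump matrix read off the table, Gram margin `r = 4`).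
[this file] -/
theorem branchedWitness_classHyps :
    (∀ a b i : Fin 4, a ≠ b → α a b i (0, 0, 1) = 0) ∧
      (∀ a d : Fin 4, 0 ≤ α a a d (0, 0, 0)) ∧
      (∀ a b d : Fin 4, a ≠ b → a ≠ d → b ≠ d → α a b d (0, 0, 0) = 0) ∧
      (∀ d ∈ ({2, 3} : Finset (Fin 4)), ∀ e : Fin 4, α d d e (0, 0, 1) = 0) ∧
      (∀ d ∈ ({2, 3} : Finset (Fin 4)), ∀ j : Fin 4, α d d j (0, 0, 0) = 0) ∧
      (∀ j ∈ ({1} : Finset (Fin 4)), ∀ c : Fin 4, α c c j (0, 0, 1) = 0) ∧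
      (∀ a j : Fin 4, j ∉ ({2, 3} : Finset (Fin 4)) → j ∉ ({1} : Finset (Fin 4)) → α a a j (0, 0, 0) = 0) ∧
      (∀ a c : Fin 4, a ∉ ({2, 3} : Finset (Fin 4)) → c ∉ ({2, 3} : Finset (Fin 4)) →
        (4 : ℝ) * ∑ e ∈ ({2, 3} : Finset (Fin 4))ᶜ, α a a e (0, 0, 1) * α c c e (0, 0, 1) ≤
          ∑ d ∈ ({2, 3} : Finset (Fin 4)), (α a a d (0, 0, 0) * α c c d (0, 0, 0) + α a a d (0, 0, 1) * α c c d (0, 0, 1))) ∧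
      α 0 0 0 (0, 0, 1) = 1 / 2 ∧ α 1 1 2 (0, 0, 1) = 1 / 2 ∧ α 0 0 3 (0, 0, 0) = 1 ∧ α 0 0 1 (0, 0, 0) = 1 / 2 := by
  refine ⟨?_, ?_, ?_, ?_, ?_, ?_, ?_, ?_, ?_, ?_, ?_, ?_⟩
  · intro a b i hab
    rw [hfeed]
    simp [hab]
  · intro a d
    rw [hin]
    fin_cases a <;> fin_cases d <;> simp
  · intro a b d hab had hbd
    rw [hin]
    fin_cases a <;> fin_cases b <;> fin_cases d <;> simp at hab had hbd ⊢
  · intro d hd e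
    simp only [Finset.mem_insert, Finset.mem_singleton] at hd
    rw [hfeed]
    rcases hd with rfl | rfl <;> fin_cases e <;> simp
  · intro d hd j
    simp only [Finset.mem_insert, Finset.mem_singleton] at hd
    rw [hin]
    rcases hd with rfl | rfl <;> fin_cases j <;> simp
  · intro j hj c
    rw [Finset.mem_singleton] at hj
    subst hj
    rw [hfeed]
    fin_cases c <;> simp
  · intro a j hj hj1
    simp only [Finset.mem_insert, Finset.mem_singleton] at hj hj1
    rw [hin]
    fin_cases a <;> fin_cases j <;> simp at hj hj1 ⊢
  · intro a c ha hc
    simp only [Finset.mem_insert, Finset.mem_singleton, not_or] at ha hc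
    rw [branchedWitness_compl, Finset.sum_insert (by decide), Finset.sum_singleton, Finset.sum_insert (by decide),
      Finset.sum_singleton]
    simp only [hfeed, hin]
    fin_cases a <;> fin_cases c <;> (simp at ha hc ⊢; try norm_num)
  · rw [hfeed]; simp
  · rw [hfeed]; simp
  · rw [hin]; simp
  · rw [hin]; simp

end BranchedWitness

/-- **THE CHAIN WITH A STRONG DEAD-END PUMP AND A PUMP-FED SIDE SOURCE obeys the ν-uniform shell barrier at EVERY scale ratio**: there is
a table of `E₂(4)`, orthant, with diagonal feeds — the Katz–Pavlović chain on `0` (weight `1/2`), a pump `0 → 3` (weight `1`) into a dead end,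
a pump `0 → 1` (weight `1/2`) into a side source that feeds the dead end `2` (weight `1/2`), i.e. the `α_SB` architecture plus a strong
pocket — on which `ShellBarrierAt R ε₀ α` holds for every `R` and EVERY `ε₀ ∈ (0, 1]` (`starvedBranched_shellBarrierAt`, `Q = {2,3}`,
`U = {1}`, `r = 4`). [this file] -/
theorem branchedWitness_nonempty_shellBarrierAt : ∃ α : Fin 4 → Fin 4 → Fin 4 → ℤ × ℤ × ℤ → ℝ,
    Literature.Analysis.FluidPDE.TaoCascade.InTableClass 4 α ∧
    (∀ (Y : Fin 4 → ℤ → ℝ → ℝ) (τ : ℝ), (∀ (j : Fin 4) (k : ℤ), 1 ≤ k → 0 ≤ Y j k τ) →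
      ∀ δ : ℝ, 0 < δ → ∀ (i : Fin 4) (n : ℤ), 1 ≤ n → Y i n τ = 0 → 0 ≤ quadTerm δ α Y i n τ) ∧
    (∀ a b i : Fin 4, a ≠ b → α a b i (0, 0, 1) = 0) ∧
    α 0 0 0 (0, 0, 1) = 1 / 2 ∧ α 1 1 2 (0, 0, 1) = 1 / 2 ∧ α 0 0 3 (0, 0, 0) = 1 ∧ α 0 0 1 (0, 0, 0) = 1 / 2 ∧
    ∀ R ε₀ : ℝ, 0 < ε₀ → ε₀ ≤ 1 → ShellBarrierAt R ε₀ α := by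
  set α : Fin 4 → Fin 4 → Fin 4 → ℤ × ℤ × ℤ → ℝ := fun i₁ i₂ i₃ μ =>
    if μ = ((0 : ℤ), (0 : ℤ), (1 : ℤ)) then
      (if i₁ = i₂ ∧ ((i₁ = 0 ∧ i₃ = 0) ∨ (i₁ = 1 ∧ i₃ = 2)) then (1 / 2 : ℝ) else 0)
    else if μ = ((1 : ℤ), (0 : ℤ), (0 : ℤ)) then
      (if i₂ = i₃ ∧ ((i₂ = 0 ∧ i₁ = 0) ∨ (i₂ = 1 ∧ i₁ = 2)) then (-(1 / 4) : ℝ) else 0)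
    else if μ = ((0 : ℤ), (1 : ℤ), (0 : ℤ)) then
      (if i₁ = i₃ ∧ ((i₁ = 0 ∧ i₂ = 0) ∨ (i₁ = 1 ∧ i₂ = 2)) then (-(1 / 4) : ℝ) else 0)
    else if μ = ((0 : ℤ), (0 : ℤ), (0 : ℤ)) then
      ((if i₁ = i₂ ∧ i₁ = 0 ∧ i₃ = 3 then (1 : ℝ) else 0) +
        (if ((i₁ = 0 ∧ i₂ = 3) ∨ (i₁ = 3 ∧ i₂ = 0)) ∧ i₃ = 0 then -(1 / 2) else 0) +
        (if i₁ = i₂ ∧ i₁ = 0 ∧ i₃ = 1 then (1 / 2 : ℝ) else 0) +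
        (if ((i₁ = 0 ∧ i₂ = 1) ∨ (i₁ = 1 ∧ i₂ = 0)) ∧ i₃ = 0 then -(1 / 4) else 0))
    else 0 with hα
  have hfeed : ∀ i₁ i₂ i₃ : Fin 4, α i₁ i₂ i₃ ((0 : ℤ), (0 : ℤ), (1 : ℤ)) =
      if i₁ = i₂ ∧ ((i₁ = 0 ∧ i₃ = 0) ∨ (i₁ = 1 ∧ i₃ = 2)) then (1 / 2 : ℝ) else 0 := fun _ _ _ => by simp [hα]
  have hup1 : ∀ i₁ i₂ i₃ : Fin 4, α i₁ i₂ i₃ ((1 : ℤ), (0 : ℤ), (0 : ℤ)) =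
      if i₂ = i₃ ∧ ((i₂ = 0 ∧ i₁ = 0) ∨ (i₂ = 1 ∧ i₁ = 2)) then (-(1 / 4) : ℝ) else 0 := fun _ _ _ => by simp [hα]
  have hup2 : ∀ i₁ i₂ i₃ : Fin 4, α i₁ i₂ i₃ ((0 : ℤ), (1 : ℤ), (0 : ℤ)) =
      if i₁ = i₃ ∧ ((i₁ = 0 ∧ i₂ = 0) ∨ (i₁ = 1 ∧ i₂ = 2)) then (-(1 / 4) : ℝ) else 0 := fun _ _ _ => by simp [hα]
  have hin : ∀ i₁ i₂ i₃ : Fin 4, α i₁ i₂ i₃ ((0 : ℤ), (0 : ℤ), (0 : ℤ)) =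
      (if i₁ = i₂ ∧ i₁ = 0 ∧ i₃ = 3 then (1 : ℝ) else 0) + (if ((i₁ = 0 ∧ i₂ = 3) ∨ (i₁ = 3 ∧ i₂ = 0)) ∧ i₃ = 0 then -(1 / 2) else 0) +
        (if i₁ = i₂ ∧ i₁ = 0 ∧ i₃ = 1 then (1 / 2 : ℝ) else 0) +
        (if ((i₁ = 0 ∧ i₂ = 1) ∨ (i₁ = 1 ∧ i₂ = 0)) ∧ i₃ = 0 then -(1 / 4) else 0) := fun _ _ _ => by simp [hα]
  obtain ⟨⟨hsymm, hcanc⟩, -⟩ := branchedWitness_symmCanc hfeed hup1 hup2 hin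
  obtain ⟨hcomp, -⟩ := branchedWitness_comparable hfeed hup1 hup2 hin
  obtain ⟨horth, -⟩ := branchedWitness_orthant hfeed hup1 hup2 hin
  obtain ⟨hD, hPnn, hCz, hQw, hQP, hU, hPQ, hGram, h00, h12, h03, h01⟩ := branchedWitness_classHyps hfeed hin
  refine ⟨α, ⟨hsymm, hcanc, hcomp⟩, horth, hD, h00, h12, h03, h01, fun R ε₀ hε hε1 => ?_⟩
  exact starvedBranched_shellBarrierAt (Q := ({2, 3} : Finset (Fin 4))) (U := ({1} : Finset (Fin 4)))
    (P := fun a d => α a a d (0, 0, 0)) (r := 4) hε hPnn (by linarith) hGram hD (fun _ _ => rfl) hCz hQw hQP hU hPQ R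

end Summit.NavierStokesRegularity.NavierStokesRegularity.Theorems

end
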